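import Summits.RiemannHypothesis.RiemannHypothesis.Theorems.JensenLogBandArcDescentIntegral
import Summits.RiemannHypothesis.RiemannHypothesis.Theorems.JensenLogBandArcSaddleDen
import HarnessLib

/-!
# Route JensenLogBand, BAND crux (stmt-RiemannHypothesis-19913) — infrastructure (S4)(0″):
# the descent density in trigonometric form (RH-FREE)

Cell rh-jensen, LADDER-RH rung J-P(P3) «log band». With the BAND lead's `saddleDen`
(`D(u) = λ′(½+u) + 1/u − (n+1)/(u+c)`, p487106) and `S_{n,c} = D − n/(u−c)`: on the circle
`u = c + h e^{it}` the term `−n/(u−c)` contributes `Re(i(u−c)·(−n/(u−c))) = Re(−in) = 0`, so the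
descent density of `JensenLogBandArcDescent` is
`Re( i(u−c)·S_{n,c}(u) ) = −h·( Re D(u)·sin t + Im D(u)·cos t )` (`descentDensity_eq_trig`).
This is the form in which the lead's `saddleDen_re_im_bounds` (`Re D ≍ ℓ_T/2`, `Im D = O(1 + ℓ_T/10)`)
feed the global descent (S4)(i) via `sub_le_neg_mul_one_sub_cos` (`JensenLogBandDescentCompare`).

WHAT THIS IS NOT: an algebraic identity; nothing here bears on zeros of `ζ` or the truth of RH.
(prover-rh-jensen-eng-2-g5-0, 2026-08-27.)
-/

noncomputable section

open Complex Metric Set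

set_option linter.dupNamespace false

namespace Summit.RiemannHypothesis.RiemannHypothesis.Theorems.JensenPolynomials.LogBandArc

open Literature.NumberTheory.LFunctions

/-- For `u − c = h e^{it}` and any `w`: `Re( i(u−c)·w ) = −h·(Re w·sin t + Im w·cos t)`. RH-FREE. -/
theorem re_I_mul_circleMap_sub_mul (c : ℂ) (h t : ℝ) (w : ℂ) :
    (I * (circleMap c h t - c) * w).re = -h * (w.re * Real.sin t + w.im * Real.cos t) := by
  rw [circleMap_sub_center, circleMap_zero, Complex.exp_mul_I]
  simp only [Complex.mul_re, Complex.mul_im, Complex.I_re, Complex.I_im, Complex.add_re,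
    Complex.add_im, Complex.ofReal_re, Complex.ofReal_im, Complex.cos_ofReal_re,
    Complex.sin_ofReal_re, Complex.cos_ofReal_im, Complex.sin_ofReal_im]
  ring

/-- The singular-looking term drops out: `Re( i(u−c)·(n/(u−c)) ) = 0` for `u ≠ c`. RH-FREE. -/
theorem re_I_mul_sub_mul_div_sub_eq_zero (n : ℕ) {c u : ℂ} (huc : u - c ≠ 0) :
    (I * (u - c) * ((n : ℂ) / (u - c))).re = 0 := by
  have e : I * (u - c) * ((n : ℂ) / (u - c)) = I * (n : ℂ) := by
    field_simp
  rw [e]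
  simp

/-- **The descent density in trigonometric form:** on the circle `u = c + h e^{it}` (`h ≠ 0`), at an
angle with `Re(½+u) > 0`, `½+u ≠ 1`:
`Re( i(u−c)·S_{n,c}(u) ) = −h·( Re D(u)·sin t + Im D(u)·cos t )`, `D = saddleDen n c`. RH-FREE. -/
theorem descentDensity_eq_trig (n : ℕ) {h : ℝ} (hh : h ≠ 0) (c : ℂ) (t : ℝ)
    (hre : 0 < (1 / 2 + circleMap c h t).re) (h1 : 1 / 2 + circleMap c h t ≠ 1) :
    (I * (circleMap c h t - c) * arcSaddleFn n c (circleMap c h t)).re =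
      -h * ((saddleDen n c (circleMap c h t)).re * Real.sin t +
        (saddleDen n c (circleMap c h t)).im * Real.cos t) := by
  have huc : circleMap c h t - c ≠ 0 := sub_ne_zero.2 (circleMap_ne_center hh)
  rw [arcSaddleFn_eq_saddleDen_sub n c hre h1, mul_sub, Complex.sub_re,
    re_I_mul_sub_mul_div_sub_eq_zero n huc, sub_zero, re_I_mul_circleMap_sub_mul]

/-- **The φ-derivative of `log ‖model integrand‖` in trigonometric form:**
`d/dt log‖arcModelIntegrand n h c t‖ = −h·(Re D(u)·sin t + Im D(u)·cos t)`. RH-FREE. -/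
theorem hasDerivAt_log_norm_arcModelIntegrand_trig (n : ℕ) {h : ℝ} (hh : h ≠ 0) (c : ℂ) (t : ℝ)
    (hre : 0 < (1 / 2 + circleMap c h t).re) (h1 : 1 / 2 + circleMap c h t ≠ 1)
    (hu0 : circleMap c h t ≠ 0) (hupc : circleMap c h t + c ≠ 0) :
    HasDerivAt (fun θ : ℝ => Real.log ‖arcModelIntegrand n h c θ‖)
      (-h * ((saddleDen n c (circleMap c h t)).re * Real.sin t +
        (saddleDen n c (circleMap c h t)).im * Real.cos t)) t := by
  rw [← descentDensity_eq_trig n hh c t hre h1]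
  exact hasDerivAt_log_norm_arcModelIntegrand n hh c t hre h1 hu0 hupc

end Summit.RiemannHypothesis.RiemannHypothesis.Theorems.JensenPolynomials.LogBandArc
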